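import Literature.NumberTheory.IwasawaTheory.ClassGroupPRankStableOfRankJumpLt
import Literature.NumberTheory.NumberFields.QuadraticGenusTwoRankExact
import Literature.NumberTheory.IwasawaTheory.ClassicalMuInvariantOnePrimeProofs
import HarnessLib

/-!
# The first layer's `2`-rank by genus theory, and the rank-jump door at the layers `(1, 2)` in UNIT currency:
# `rank₂ Cl(K_1) + 1 + ord₂ [E_K : E_K ∩ N K_1ˣ] = t₁`, hence `rank₂ Cl(K_2) + ord₂ [E_K : E_K ∩ N K_1ˣ] ≤ t₁ ⟹ μ₂ = 0` (odd `h_K`)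

`Proofs`-style file (theorems only: no definition, no named fact, no `sorry`) in topic `NumberTheory/IwasawaTheory` (namespace = path), written by
the prover seat `bsd-line-att-p3` g40 (cell `bsd-f1-sign2`, route `AlignedTransportAtTwo`; `--supports` stmt-BirchSwinnertonDyer-22298, closes nothing).
It glues this seat's exact genus `2`-rank (`NumberFields/QuadraticGenusTwoRankExact`, Gras IV.4) to the `ℤ₂`-tower currency `classGroupPRank κ 1` and to
the rank-jump door (`ClassGroupPRankStableOfRankJumpLt`, pair `(1,2)`).

* ★ `classGroupPRank_one_add_one_add_padicValNat_eq_ncard` — `κ` a `ℤ₂`-extension of a number field `K` with `h_K` ODD: **`r_1 + 1 + ord₂ [E_K : E_K ∩ N_{K_1/K} K_1ˣ] = t₁`**,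
  `t₁` the number of primes of `K` ramified in `K_1` (`K_1/K` is Galois quadratic and unramified at infinity).
* ★★ `classGroupPRank_eq_and_classicalMuVanishes_two_of_add_padicValNat_le_ncard` — with Fukuda index `0`: **`r_2 + ord₂ [E_K : E_K ∩ N K_1ˣ] ≤ t₁ ⟹`
  `2`-ranks frozen from `K_2`, `μ₂ = 0`, `λ₂ ≤ r_2`** (this is `r_2 ≤ r_1 + 1`); W-free packaging `…_of_not_dvd_discr` for `K` of odd degree with `2 ∤ d_K` and
  `κ` cyclotomic.  Cell reading (split stratum: complex cubic `F`, `h_F` odd, three primes above `2`, `t₁ = 3`, `[E_F : E_F ∩ N F_1ˣ] ∈ {1, 2}`):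
  «`rank₂ Cl(F_2) + [ε_F ∉ N F_1ˣ] ≤ 3`».

References: [Gras2003] IV.4; [Fukuda1994] Thm. 1 (2); [Washington1997] §13.1 Prop. 13.2, §13.3 Prop. 13.22–13.23; [Lang1990] Ch. 13 §4 Lemma 4.1.
-/

set_option autoImplicit false

noncomputable section

open scoped NumberField
open NumberField IsDedekindDomain

namespace Literature.NumberTheory.IwasawaTheory

open Literature.NumberTheory.EllipticCurves Literature.NumberTheory.NumberFields Literature.NumberTheory.NumberFields.AmbiguousClass
  Literature.NumberTheory.GaloisRepresentations Literature.NumberTheory.GaloisRepresentations.Herbrand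
  Literature.NumberTheory.GaloisRepresentations.MinkowskiUnit Literature.NumberTheory.GaloisRepresentations.CyclicNormIndex

variable {K : Type} [Field K] [NumberField K]

/-- ★ **The first layer's `2`-rank by genus theory**: `κ` a `ℤ₂`-extension of `K`, `h_K` odd ⟹
`rank₂ Cl(K_1) + 1 + ord₂ [E_K : E_K ∩ N_{K_1/K} K_1ˣ] = #{primes of K ramified in K_1}` (`K_1/K` Galois of degree `2`, unramified at the infinite places
— Washington Prop. 13.2 —, so Gras IV.4 applies: tree `padicValNat_two_index_pow_two_add_eq_ncard_of_odd_classNumber`).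
[cite: Gras2003, IV.4] [cite: Washington1997, §13.1 Prop. 13.2] -/
theorem classGroupPRank_one_add_one_add_padicValNat_eq_ncard (κ : ZpExtension K 2) [NumberField (κ.layer 1)]
    (hodd : Odd (classNumber K)) :
    classGroupPRank κ 1 + 1 +
        padicValNat 2 ((unitsE (κ.layer 1) ⊓ (⊤ : Subgroup (κ.layer 1)ˣ).map
            (Herbrand.norm ((κ.layer 1) ≃ₐ[K] (κ.layer 1)))).relIndex (unitsE (κ.layer 1) ⊓ (unitsIncl K (κ.layer 1)).range)) =
      {v : HeightOneSpectrum (𝓞 K) | v.asIdeal.ramificationIdxIn (𝓞 (κ.layer 1)) ≠ 1}.ncard := by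
  haveI : FiniteDimensional K (κ.layer 1) := κ.finiteDimensional_layer_holds 1
  haveI : IsGalois K (κ.layer 1) := κ.isGalois_layer_holds 1
  haveI : IsUnramifiedAtInfinitePlaces K (κ.layer 1) := κ.isUnramifiedAtInfinitePlaces_layer 1
  have hdeg : Module.finrank K (κ.layer 1) = 2 := by rw [κ.finrank_layer_holds 1, pow_one]
  have h := padicValNat_two_index_pow_two_add_eq_ncard_of_odd_classNumber (K := K) (L := κ.layer 1) hdeg hodd
  rw [classGroupPRank_def, ← Subgroup.index_eq_card]
  exact h

/-- ★★ **The `(1,2)` rank-jump door in unit currency.**  `κ` a `ℤ₂`-extension of `K` with Fukuda index `0` (`TotallyRamifiedFrom κ 0`) and `h_K` odd: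
**`rank₂ Cl(K_2) + ord₂ [E_K : E_K ∩ N K_1ˣ] ≤ #{primes of K ramified in K_1}` ⟹ `rank₂ Cl(K_m) = rank₂ Cl(K_2)` for all `m ≥ 2`, `μ₂ = 0`, `λ₂ ≤ rank₂ Cl(K_2)`**
— by the previous theorem the hypothesis is exactly `rank₂ Cl(K_2) ≤ rank₂ Cl(K_1) + 1` (tree `classGroupPRank_eq_of_le_succ_two`).
[cite: Fukuda1994, Thm. 1 (2), p. 264] [cite: Gras2003, IV.4] [cite: Washington1997, §13.3 Prop. 13.22–13.23 and Thm. 13.13] -/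
theorem classGroupPRank_eq_and_classicalMuVanishes_two_of_add_padicValNat_le_ncard (κ : ZpExtension K 2) [NumberField (κ.layer 1)]
    (hκ : TotallyRamifiedFrom κ 0) (hodd : Odd (classNumber K))
    (hjump : classGroupPRank κ 2 +
        padicValNat 2 ((unitsE (κ.layer 1) ⊓ (⊤ : Subgroup (κ.layer 1)ˣ).map
            (Herbrand.norm ((κ.layer 1) ≃ₐ[K] (κ.layer 1)))).relIndex (unitsE (κ.layer 1) ⊓ (unitsIncl K (κ.layer 1)).range)) ≤
      {v : HeightOneSpectrum (𝓞 K) | v.asIdeal.ramificationIdxIn (𝓞 (κ.layer 1)) ≠ 1}.ncard) :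
    (∀ m, 2 ≤ m → classGroupPRank κ m = classGroupPRank κ 2) ∧
      ClassicalMuVanishes κ ∧ classicalLambda κ ≤ classGroupPRank κ 2 := by
  have h1 := classGroupPRank_one_add_one_add_padicValNat_eq_ncard κ hodd
  have hj : classGroupPRank κ (0 + 2) ≤ classGroupPRank κ (0 + 1) + 1 := by
    simp only [Nat.zero_add]
    omega
  refine ⟨fun m hm => ?_, classicalMuVanishes_and_classicalLambda_le_of_le_succ_two κ hκ le_rfl hj⟩
  simpa only [Nat.zero_add] using classGroupPRank_eq_of_le_succ_two κ hκ le_rfl hj (m := m) (by omega)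

/-- ★★ **W-free packaging**: `K` of odd degree with `2 ∤ d_K` and ODD class number, `κ` a cyclotomic `ℤ₂`-extension (Fukuda index `0` by
`totallyRamifiedFrom_zero_of_not_dvd_discr`): **`rank₂ Cl(K_2) + ord₂ [E_K : E_K ∩ N K_1ˣ] ≤ #{primes of K ramified in K_1}` ⟹ `μ₂ = 0` and
`λ₂ ≤ rank₂ Cl(K_2)`** (and the `2`-ranks are frozen from `K_2`).  For a complex cubic field with `2` split: `t₁ = 3`, `[E_K : E_K ∩ N K_1ˣ] ∣ 2`
(`−1 = N(1 + √2)`), so the hypothesis reads `rank₂ Cl(K_2) ≤ 3 − [ε ∉ N K_1ˣ]`. [cite: Fukuda1994, Thm. 1 (2), p. 264] [cite: Gras2003, IV.4]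
[cite: Washington1997, §13.1 Lemma 13.3 and §13.3 Prop. 13.23] -/
theorem classicalMuVanishes_two_of_add_padicValNat_le_ncard_of_not_dvd_discr (hK : ¬ 2 ∣ Module.finrank ℚ K)
    (hd : ¬ (2 : ℤ) ∣ NumberField.discr K) (hodd : Odd (classNumber K)) (κ : ZpExtension K 2) (hκ : κ.IsCyclotomic)
    [NumberField (κ.layer 1)]
    (hjump : classGroupPRank κ 2 +
        padicValNat 2 ((unitsE (κ.layer 1) ⊓ (⊤ : Subgroup (κ.layer 1)ˣ).map
            (Herbrand.norm ((κ.layer 1) ≃ₐ[K] (κ.layer 1)))).relIndex (unitsE (κ.layer 1) ⊓ (unitsIncl K (κ.layer 1)).range)) ≤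
      {v : HeightOneSpectrum (𝓞 K) | v.asIdeal.ramificationIdxIn (𝓞 (κ.layer 1)) ≠ 1}.ncard) :
    (∀ m, 2 ≤ m → classGroupPRank κ m = classGroupPRank κ 2) ∧
      ClassicalMuVanishes κ ∧ classicalLambda κ ≤ classGroupPRank κ 2 :=
  classGroupPRank_eq_and_classicalMuVanishes_two_of_add_padicValNat_le_ncard κ
    (totallyRamifiedFrom_zero_of_not_dvd_discr hK hd κ hκ) hodd hjump

end Literature.NumberTheory.IwasawaTheory

end
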